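import Summits.CriticalPhenomena.PercolationContinuityZ3.Theorems.PercAnnulusCrossingIICSchemeHypotheses
import Literature.Analysis.Convexity.KestenRatioScheme
import HarnessLib

/-!
# Kesten–Basu–Sapozhnikov IIC scheme in boxes, XVII: Kesten's scheme bounds the oscillation of `γ_n / γ_{n'}` (lane RSW3, p1 gen 3)

builds on p205010 (kernel theorem, internal audit signed; external expert review pending)

Seat `prim-rsw3-p1` (gen 3); LANE-4 blueprint, memo `run/shared/lean/prim/rsw3/P1-QM.md` §13.4 step (4).  Helper file; no definitions, no
sorries.  Scheme levels `l = 0` (outermost) … `L` (innermost) with annuli `(2 M1 l, 2 M2 l)` and inward shells `(2 μ1 l − 1, 2 μ2 l)`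
(`l < L`); index sets `s l = {D ∈ 𝒟_l : γ_n(D) > 0, P(DAT_l(D)) > 0, (l < L → β_l(D) > 0)}`; kernels `M_l(C;D)`; level vectors
`U = γ_n`, `U' = γ_{n'}` (`4 M2 0 < n' ≤ n`); cross-ratio constant `K = ϰ⁻²` (`0 < ϰ ≤ 1`); junk `ε`.
* **`conn_ratio_osc_le`** — `Literature.Analysis.Convexity.KestenRatioScheme.kesten_multilevel_osc_le` applied to these data: for all
  top-level data `C, C'` with `γ_n > 0` and `P(DAT_L) > 0`:  `γ_n(C) γ_{n'}(C') ≤ Q L · γ_n(C') γ_{n'}(C)` for every solution `Q` of Kesten's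
  recursion — the one-arm ratio-limit mechanism of Kesten (1986) / Basu–Sapozhnikov (2017) for Bernoulli percolation on `ℤ^d` under (A2)□.
References: H. Kesten, PTRF 73 (1986) §2 (22)–(25); D. Basu, A. Sapozhnikov, ECP 22 (2017) no. 26, §2.
-/

noncomputable section

namespace Summit.CriticalPhenomena.PercolationContinuityZ3.Theorems.Crossing

open MeasureTheory Literature.Probability.Percolation Literature.Probability.LatticeModels
open Literature.Probability.Percolation.DCT16
open Summit.CriticalPhenomena.PercolationContinuityZ3.Theorems.SurfaceTension
open scoped Literature.Probability.Percolation
open Literature.Analysis.Convexity.Doeblin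

variable {d : ℕ}

/-- **Kesten's scheme for the IIC in boxes: the oscillation bound.**  See the module docstring for the data; hypotheses: `0 < p`,
`0 < ϰ ≤ 1`, (A2)□(ϰ), `1 ≤ L`, scales with `1 ≤ M1 l`, `4 M1 l < 2 M2 l` (`l ≤ L`), `2(2 M2 (l+1) + 1) + 1 ≤ μ1 l`, `4 μ1 l < 2 μ2 l ≤ 2 M1 l`
and junk `α(2μ1 l, 2μ2 l) + α(2M1 l, 2M2 l) ≤ ϰ² ε` (`l < L`), `0 ≤ ε < 1`, `Q` a solution of Kesten's recursion with `K = 1/ϰ²`, and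
`4 M2 0 < n' ≤ n`. [cite: Kesten1986, §2 (22)–(25)] [cite: BasuSapozhnikov2017ECP, Thm. 1.1] -/
theorem conn_ratio_osc_le (p : unitInterval) (hp : 0 < (p : ℝ)) {ϰ ε : ℝ} (hϰ : 0 < ϰ) (hϰ1 : ϰ ≤ 1)
    (hA2 : ∀ m : ℕ, 1 ≤ m → ∀ Z : Finset (Site d), box d (4 * m) \ box d (m - 1) ⊆ Z →
      ∀ X : Finset (Site d), X ⊆ Z ∩ box d m → ∀ Y : Finset (Site d), Y ⊆ Z \ box d (4 * m) →
        ϰ * (bondPercolation (zdGraph d) p).real {ω | ∃ x ∈ X, ∃ s ∈ innerBoundary (zdGraph d) (box d (2 * m)),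
              ω ∈ openConnIn (↑Z : Set (Site d)) x s} *
          (bondPercolation (zdGraph d) p).real {ω | ∃ y ∈ Y, ∃ s ∈ innerBoundary (zdGraph d) (box d (2 * m)),
              ω ∈ openConnIn (↑Z : Set (Site d)) y s} ≤
        (bondPercolation (zdGraph d) p).real {ω | ∃ x ∈ X, ∃ y ∈ Y, ω ∈ openConnIn (↑Z : Set (Site d)) x y})
    {L : ℕ} (hL : 1 ≤ L) {M1 M2 μ1 μ2 : ℕ → ℕ}
    (hM : ∀ l ≤ L, 1 ≤ M1 l ∧ 4 * M1 l < 2 * M2 l)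
    (hμ : ∀ l < L, 2 * (2 * M2 (l + 1) + 1) + 1 ≤ μ1 l ∧ 4 * μ1 l < 2 * μ2 l ∧ μ2 l ≤ M1 l)
    (hjunk : ∀ l < L, (bondPercolation (zdGraph d) p).real (boxCrossing d (2 * μ1 l) (2 * μ2 l)) +
      (bondPercolation (zdGraph d) p).real (boxCrossing d (2 * M1 l) (2 * M2 l)) ≤ ϰ ^ 2 * ε)
    (hε0 : 0 ≤ ε) (hε1 : ε < 1) (Q : ℕ → ℝ) (hQ1 : (1 / ϰ ^ 2) / (1 - ε) ^ 2 ≤ Q 1)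
    (hQ : ∀ l : ℕ, 1 ≤ l → (1 / (1 / ϰ ^ 2) + (1 - 1 / (1 / ϰ ^ 2)) * Q l) / (1 - ε) ^ 2 ≤ Q (l + 1))
    {n n' : ℕ} (hn' : 4 * M2 0 < n') (hnn' : n' ≤ n)
    {C C' : Finset (Site d) × Finset (Site d)} (hC : C ∈ ((box d (2 * M2 L)).powerset.filter (fun U => box d (2 * M1 L) ⊆ U)) ×ˢ (box d (2 * M2 L + 1)).powerset)
    (hC' : C' ∈ ((box d (2 * M2 L)).powerset.filter (fun U => box d (2 * M1 L) ⊆ U)) ×ˢ (box d (2 * M2 L + 1)).powerset)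
    (hCγ : 0 < (bondPercolation (zdGraph d) p).real {ω : BondConfig (Site d) | ∃ x ∈ C.2, ∃ t ∈ innerBoundary (zdGraph d) (box d n),
            ω ∈ openConnIn ((↑(box d n) : Set (Site d)) \ ↑C.1) x t})
    (hCD : 0 < (bondPercolation (zdGraph d) p).real {ω : BondConfig (Site d) | ω ∩ (↑((box d (2 * M2 L + 1)).sym2) : Set (Sym2 (Site d))) ∈
            explEvent (↑(box d (2 * M1 L)) : Set (Site d)) ((↑(box d (2 * M2 L)) : Set (Site d)) \ ↑(box d (2 * M1 L))) ↑C.1 ↑C.2})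
    (hC'γ : 0 < (bondPercolation (zdGraph d) p).real {ω : BondConfig (Site d) | ∃ x ∈ C'.2, ∃ t ∈ innerBoundary (zdGraph d) (box d n),
            ω ∈ openConnIn ((↑(box d n) : Set (Site d)) \ ↑C'.1) x t})
    (hC'D : 0 < (bondPercolation (zdGraph d) p).real {ω : BondConfig (Site d) | ω ∩ (↑((box d (2 * M2 L + 1)).sym2) : Set (Sym2 (Site d))) ∈
            explEvent (↑(box d (2 * M1 L)) : Set (Site d)) ((↑(box d (2 * M2 L)) : Set (Site d)) \ ↑(box d (2 * M1 L))) ↑C'.1 ↑C'.2}) :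
    (bondPercolation (zdGraph d) p).real {ω : BondConfig (Site d) | ∃ x ∈ C.2, ∃ t ∈ innerBoundary (zdGraph d) (box d n),
            ω ∈ openConnIn ((↑(box d n) : Set (Site d)) \ ↑C.1) x t} *
      (bondPercolation (zdGraph d) p).real {ω : BondConfig (Site d) | ∃ x ∈ C'.2, ∃ t ∈ innerBoundary (zdGraph d) (box d n'),
            ω ∈ openConnIn ((↑(box d n') : Set (Site d)) \ ↑C'.1) x t} ≤
      Q L * ((bondPercolation (zdGraph d) p).real {ω : BondConfig (Site d) | ∃ x ∈ C'.2, ∃ t ∈ innerBoundary (zdGraph d) (box d n),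
            ω ∈ openConnIn ((↑(box d n) : Set (Site d)) \ ↑C'.1) x t} *
        (bondPercolation (zdGraph d) p).real {ω : BondConfig (Site d) | ∃ x ∈ C.2, ∃ t ∈ innerBoundary (zdGraph d) (box d n'),
            ω ∈ openConnIn ((↑(box d n') : Set (Site d)) \ ↑C.1) x t}) := by
  classical
  -- the scheme data
  set 𝒮 : ℕ → Finset (Finset (Site d) × Finset (Site d)) := fun l =>
    ((((box d (2 * M2 l)).powerset.filter (fun U => box d (2 * M1 l) ⊆ U)) ×ˢ (box d (2 * M2 l + 1)).powerset).filter (fun D =>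
          0 < (bondPercolation (zdGraph d) p).real {ω : BondConfig (Site d) | ∃ x ∈ D.2, ∃ t ∈ innerBoundary (zdGraph d) (box d n),
            ω ∈ openConnIn ((↑(box d n) : Set (Site d)) \ ↑D.1) x t} ∧
          0 < (bondPercolation (zdGraph d) p).real {ω : BondConfig (Site d) | ω ∩ (↑((box d (2 * M2 l + 1)).sym2) : Set (Sym2 (Site d))) ∈
            explEvent (↑(box d (2 * M1 l)) : Set (Site d)) ((↑(box d (2 * M2 l)) : Set (Site d)) \ ↑(box d (2 * M1 l))) ↑D.1 ↑D.2} ∧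
          (L ≤ l ∨ 0 < (∑ I ∈ (box d (2 * μ2 l - 1) \ box d (2 * μ1 l - 1)).powerset ×ˢ (innerBoundary (zdGraph d) (box d (2 * μ1 l - 1))).powerset,
        (bondPercolation (zdGraph d) p).real {ω : BondConfig (Site d) | ∃ y ∈ I.2, ∃ w ∈ innerBoundary (zdGraph d) (box d (2 * (2 * M2 (l + 1) + 1))),
          ω ∈ openConnIn ((↑(box d (2 * μ2 l)) : Set (Site d)) \ (↑(I.1 ∪ innerBoundary (zdGraph d) (box d (2 * μ2 l))) ∪ ↑(box d (2 * (2 * M2 (l + 1) + 1) - 1)))) y w} *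
        (bondPercolation (zdGraph d) p).real
          ({ω : BondConfig (Site d) | ω ∩ (↑((box d (2 * μ2 l)).sym2) : Set (Sym2 (Site d))) ∈
                explEvent ((↑(box d (2 * μ2 l - 1)) : Set (Site d))ᶜ) ((↑(box d (2 * μ2 l - 1)) : Set (Site d)) \ ↑(box d (2 * μ1 l - 1)))
                  ((↑(box d (2 * μ2 l - 1)) : Set (Site d))ᶜ ∪ ↑I.1) ↑I.2} ∩
           {ω : BondConfig (Site d) | ∀ y ∈ I.2, ∀ y' ∈ I.2, ∀ z ∈ I.1 ∪ innerBoundary (zdGraph d) (box d (2 * μ2 l)),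
                ∀ z' ∈ I.1 ∪ innerBoundary (zdGraph d) (box d (2 * μ2 l)), s(z, y) ∈ ω → s(z', y') ∈ ω →
                ω ∈ openConnIn (↑(I.1 ∪ innerBoundary (zdGraph d) (box d (2 * μ2 l))) : Set (Site d)) z z'} ∩
           {ω : BondConfig (Site d) | ∃ y ∈ I.2, ∃ z ∈ I.1 ∪ innerBoundary (zdGraph d) (box d (2 * μ2 l)), s(z, y) ∈ ω ∧
            ∃ r ∈ D.2, ∃ v ∈ D.1, ω ∈ openConnIn ((↑(I.1 ∪ innerBoundary (zdGraph d) (box d (2 * μ2 l))) : Set (Site d)) ∪ (↑D.1 \ ↑(box d (2 * μ2 l)))) z v ∧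
              s(v, r) ∈ ω} ∩
           {ω : BondConfig (Site d) | ω ∩ (↑((box d (2 * M2 l + 1)).sym2) : Set (Sym2 (Site d))) ∈
            explEvent (↑(box d (2 * M1 l)) : Set (Site d)) ((↑(box d (2 * M2 l)) : Set (Site d)) \ ↑(box d (2 * M1 l))) ↑D.1 ↑D.2} ∩
           {ω : BondConfig (Site d) | ∀ r ∈ D.2, ∀ r' ∈ D.2, ∃ v ∈ D.1, ∃ v' ∈ D.1,
            s(v, r) ∈ ω ∧ s(v', r') ∈ ω ∧ ω ∈ openConnIn ((↑D.1 : Set (Site d)) \ ↑(box d (2 * M1 l - 1))) v v'}))))) with h𝒮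
  set Kf : ℕ → Finset (Site d) × Finset (Site d) → Finset (Site d) × Finset (Site d) → ℝ := fun l C D =>
    (bondPercolation (zdGraph d) p).real
        ((⋃ I ∈ (box d (2 * μ2 l - 1) \ box d (2 * μ1 l - 1)).powerset ×ˢ (innerBoundary (zdGraph d) (box d (2 * μ1 l - 1))).powerset,
            ({ω : BondConfig (Site d) | ω ∩ (↑((box d (2 * μ2 l)).sym2) : Set (Sym2 (Site d))) ∈
                explEvent ((↑(box d (2 * μ2 l - 1)) : Set (Site d))ᶜ) ((↑(box d (2 * μ2 l - 1)) : Set (Site d)) \ ↑(box d (2 * μ1 l - 1)))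
                  ((↑(box d (2 * μ2 l - 1)) : Set (Site d))ᶜ ∪ ↑I.1) ↑I.2} ∩
             {ω : BondConfig (Site d) | ∀ y ∈ I.2, ∀ y' ∈ I.2, ∀ z ∈ I.1 ∪ innerBoundary (zdGraph d) (box d (2 * μ2 l)),
                ∀ z' ∈ I.1 ∪ innerBoundary (zdGraph d) (box d (2 * μ2 l)), s(z, y) ∈ ω → s(z', y') ∈ ω →
                ω ∈ openConnIn (↑(I.1 ∪ innerBoundary (zdGraph d) (box d (2 * μ2 l))) : Set (Site d)) z z'})) ∩
          ({ω : BondConfig (Site d) | ∃ x ∈ C.2, ∃ r ∈ D.2, ∃ v ∈ D.1, ω ∈ openConnIn ((↑D.1 : Set (Site d)) \ ↑C.1) x v ∧ s(v, r) ∈ ω} ∩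
           {ω : BondConfig (Site d) | ω ∩ (↑((box d (2 * M2 l + 1)).sym2) : Set (Sym2 (Site d))) ∈
            explEvent (↑(box d (2 * M1 l)) : Set (Site d)) ((↑(box d (2 * M2 l)) : Set (Site d)) \ ↑(box d (2 * M1 l))) ↑D.1 ↑D.2} ∩
           {ω : BondConfig (Site d) | ∀ r ∈ D.2, ∀ r' ∈ D.2, ∃ v ∈ D.1, ∃ v' ∈ D.1,
            s(v, r) ∈ ω ∧ s(v', r') ∈ ω ∧ ω ∈ openConnIn ((↑D.1 : Set (Site d)) \ ↑(box d (2 * M1 l - 1))) v v'})) with hKf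
  set γf : ℕ → Finset (Site d) × Finset (Site d) → ℝ := fun N D =>
    (bondPercolation (zdGraph d) p).real {ω : BondConfig (Site d) | ∃ x ∈ D.2, ∃ t ∈ innerBoundary (zdGraph d) (box d N),
            ω ∈ openConnIn ((↑(box d N) : Set (Site d)) \ ↑D.1) x t} with hγf
  -- monotonicity of the outer radii
  have hmono : ∀ l ≤ L, M2 l ≤ M2 0 := by
    intro l hl
    induction l with
    | zero => exact le_rfl
    | succ l ih =>
      have h1 := hμ l (by omega)
      have h2 := hM l (by omega)
      have : M2 (l + 1) ≤ M2 l := by omega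
      exact this.trans (ih (by omega))
  have hn'l : ∀ l ≤ L, 4 * M2 l < n' := fun l hl => lt_of_le_of_lt (Nat.mul_le_mul_left 4 (hmono l hl)) hn'
  have hK : (1 : ℝ) ≤ 1 / ϰ ^ 2 := by
    rw [le_div_iff₀ (by positivity), one_mul]
    exact pow_le_one₀ hϰ.le hϰ1
  -- membership facts
  have facts : ∀ l ≤ L, ∀ D ∈ 𝒮 l,
      (D.1 ⊆ box d (2 * M2 l) ∧ box d (2 * M1 l) ⊆ D.1 ∧ D.2 ⊆ box d (2 * M2 l + 1)) ∧ 0 < γf n D ∧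
      0 < (bondPercolation (zdGraph d) p).real {ω : BondConfig (Site d) | ω ∩ (↑((box d (2 * M2 l + 1)).sym2) : Set (Sym2 (Site d))) ∈
            explEvent (↑(box d (2 * M1 l)) : Set (Site d)) ((↑(box d (2 * M2 l)) : Set (Site d)) \ ↑(box d (2 * M1 l))) ↑D.1 ↑D.2} ∧
      (L ≤ l ∨ 0 < (∑ I ∈ (box d (2 * μ2 l - 1) \ box d (2 * μ1 l - 1)).powerset ×ˢ (innerBoundary (zdGraph d) (box d (2 * μ1 l - 1))).powerset,
        (bondPercolation (zdGraph d) p).real {ω : BondConfig (Site d) | ∃ y ∈ I.2, ∃ w ∈ innerBoundary (zdGraph d) (box d (2 * (2 * M2 (l + 1) + 1))),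
          ω ∈ openConnIn ((↑(box d (2 * μ2 l)) : Set (Site d)) \ (↑(I.1 ∪ innerBoundary (zdGraph d) (box d (2 * μ2 l))) ∪ ↑(box d (2 * (2 * M2 (l + 1) + 1) - 1)))) y w} *
        (bondPercolation (zdGraph d) p).real
          ({ω : BondConfig (Site d) | ω ∩ (↑((box d (2 * μ2 l)).sym2) : Set (Sym2 (Site d))) ∈
                explEvent ((↑(box d (2 * μ2 l - 1)) : Set (Site d))ᶜ) ((↑(box d (2 * μ2 l - 1)) : Set (Site d)) \ ↑(box d (2 * μ1 l - 1)))
                  ((↑(box d (2 * μ2 l - 1)) : Set (Site d))ᶜ ∪ ↑I.1) ↑I.2} ∩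
           {ω : BondConfig (Site d) | ∀ y ∈ I.2, ∀ y' ∈ I.2, ∀ z ∈ I.1 ∪ innerBoundary (zdGraph d) (box d (2 * μ2 l)),
                ∀ z' ∈ I.1 ∪ innerBoundary (zdGraph d) (box d (2 * μ2 l)), s(z, y) ∈ ω → s(z', y') ∈ ω →
                ω ∈ openConnIn (↑(I.1 ∪ innerBoundary (zdGraph d) (box d (2 * μ2 l))) : Set (Site d)) z z'} ∩
           {ω : BondConfig (Site d) | ∃ y ∈ I.2, ∃ z ∈ I.1 ∪ innerBoundary (zdGraph d) (box d (2 * μ2 l)), s(z, y) ∈ ω ∧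
            ∃ r ∈ D.2, ∃ v ∈ D.1, ω ∈ openConnIn ((↑(I.1 ∪ innerBoundary (zdGraph d) (box d (2 * μ2 l))) : Set (Site d)) ∪ (↑D.1 \ ↑(box d (2 * μ2 l)))) z v ∧
              s(v, r) ∈ ω} ∩
           {ω : BondConfig (Site d) | ω ∩ (↑((box d (2 * M2 l + 1)).sym2) : Set (Sym2 (Site d))) ∈
            explEvent (↑(box d (2 * M1 l)) : Set (Site d)) ((↑(box d (2 * M2 l)) : Set (Site d)) \ ↑(box d (2 * M1 l))) ↑D.1 ↑D.2} ∩
           {ω : BondConfig (Site d) | ∀ r ∈ D.2, ∀ r' ∈ D.2, ∃ v ∈ D.1, ∃ v' ∈ D.1,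
            s(v, r) ∈ ω ∧ s(v', r') ∈ ω ∧ ω ∈ openConnIn ((↑D.1 : Set (Site d)) \ ↑(box d (2 * M1 l - 1))) v v'}))) ∧
      (∀ r ∈ D.2, r ∉ box d (2 * M2 l)) ∧ (∀ r ∈ D.2, r ∉ D.1) := by
    intro l hl D hD
    simp only [h𝒮, Finset.mem_filter, Finset.mem_product, Finset.mem_powerset] at hD
    obtain ⟨⟨⟨hUb, hUa⟩, hR⟩, hγ, hdat, hβ⟩ := hD
    have hMl := hM l hl
    exact ⟨⟨hUb, hUa, hR⟩, hγ, hdat, hβ, fun r hr hrb => hdat.ne' (real_dat_eq_zero_of_mem_box p (by omega) hUb hr hrb),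
      fun r hr hrU => hdat.ne' (real_dat_eq_zero_of_mem_left p (by omega) hUb hr hrU)⟩
  have hCs : C ∈ 𝒮 L := by
    simp only [h𝒮, Finset.mem_filter]; exact ⟨hC, hCγ, hCD, Or.inl le_rfl⟩
  have hC's : C' ∈ 𝒮 L := by
    simp only [h𝒮, Finset.mem_filter]; exact ⟨hC', hC'γ, hC'D, Or.inl le_rfl⟩
  -- hypothesis hU / hU' at level `l < L`, for `n' ≤ N ≤ n`
  have hUN : ∀ N : ℕ, n' ≤ N → N ≤ n → ∀ l < L, ∀ C ∈ 𝒮 (l + 1),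
      ∑ D ∈ 𝒮 l, Kf l C D * γf N D ≤ γf N C ∧ (1 - ε) * γf N C ≤ ∑ D ∈ 𝒮 l, Kf l C D * γf N D := by
    intro N hN1 hN2 l hl C hC
    obtain ⟨⟨hH, -, hX⟩, -, -, -, -, hXH⟩ := facts (l + 1) (by omega) C hC
    obtain ⟨h1, h2, h3⟩ := hμ l hl
    obtain ⟨h4, h5⟩ := hM l (by omega)
    have hfl : 𝒮 l = ((((box d (2 * M2 l)).powerset.filter (fun U => box d (2 * M1 l) ⊆ U)) ×ˢ (box d (2 * M2 l + 1)).powerset).filter (fun D =>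
          0 < (bondPercolation (zdGraph d) p).real {ω : BondConfig (Site d) | ∃ x ∈ D.2, ∃ t ∈ innerBoundary (zdGraph d) (box d n),
            ω ∈ openConnIn ((↑(box d n) : Set (Site d)) \ ↑D.1) x t} ∧
          0 < (bondPercolation (zdGraph d) p).real {ω : BondConfig (Site d) | ω ∩ (↑((box d (2 * M2 l + 1)).sym2) : Set (Sym2 (Site d))) ∈
            explEvent (↑(box d (2 * M1 l)) : Set (Site d)) ((↑(box d (2 * M2 l)) : Set (Site d)) \ ↑(box d (2 * M1 l))) ↑D.1 ↑D.2} ∧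
          0 < (∑ I ∈ (box d (2 * μ2 l - 1) \ box d (2 * μ1 l - 1)).powerset ×ˢ (innerBoundary (zdGraph d) (box d (2 * μ1 l - 1))).powerset,
        (bondPercolation (zdGraph d) p).real {ω : BondConfig (Site d) | ∃ y ∈ I.2, ∃ w ∈ innerBoundary (zdGraph d) (box d (2 * (2 * M2 (l + 1) + 1))),
          ω ∈ openConnIn ((↑(box d (2 * μ2 l)) : Set (Site d)) \ (↑(I.1 ∪ innerBoundary (zdGraph d) (box d (2 * μ2 l))) ∪ ↑(box d (2 * (2 * M2 (l + 1) + 1) - 1)))) y w} *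
        (bondPercolation (zdGraph d) p).real
          ({ω : BondConfig (Site d) | ω ∩ (↑((box d (2 * μ2 l)).sym2) : Set (Sym2 (Site d))) ∈
                explEvent ((↑(box d (2 * μ2 l - 1)) : Set (Site d))ᶜ) ((↑(box d (2 * μ2 l - 1)) : Set (Site d)) \ ↑(box d (2 * μ1 l - 1)))
                  ((↑(box d (2 * μ2 l - 1)) : Set (Site d))ᶜ ∪ ↑I.1) ↑I.2} ∩
           {ω : BondConfig (Site d) | ∀ y ∈ I.2, ∀ y' ∈ I.2, ∀ z ∈ I.1 ∪ innerBoundary (zdGraph d) (box d (2 * μ2 l)),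
                ∀ z' ∈ I.1 ∪ innerBoundary (zdGraph d) (box d (2 * μ2 l)), s(z, y) ∈ ω → s(z', y') ∈ ω →
                ω ∈ openConnIn (↑(I.1 ∪ innerBoundary (zdGraph d) (box d (2 * μ2 l))) : Set (Site d)) z z'} ∩
           {ω : BondConfig (Site d) | ∃ y ∈ I.2, ∃ z ∈ I.1 ∪ innerBoundary (zdGraph d) (box d (2 * μ2 l)), s(z, y) ∈ ω ∧
            ∃ r ∈ D.2, ∃ v ∈ D.1, ω ∈ openConnIn ((↑(I.1 ∪ innerBoundary (zdGraph d) (box d (2 * μ2 l))) : Set (Site d)) ∪ (↑D.1 \ ↑(box d (2 * μ2 l)))) z v ∧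
              s(v, r) ∈ ω} ∩
           {ω : BondConfig (Site d) | ω ∩ (↑((box d (2 * M2 l + 1)).sym2) : Set (Sym2 (Site d))) ∈
            explEvent (↑(box d (2 * M1 l)) : Set (Site d)) ((↑(box d (2 * M2 l)) : Set (Site d)) \ ↑(box d (2 * M1 l))) ↑D.1 ↑D.2} ∩
           {ω : BondConfig (Site d) | ∀ r ∈ D.2, ∀ r' ∈ D.2, ∃ v ∈ D.1, ∃ v' ∈ D.1,
            s(v, r) ∈ ω ∧ s(v', r') ∈ ω ∧ ω ∈ openConnIn ((↑D.1 : Set (Site d)) \ ↑(box d (2 * M1 l - 1))) v v'})))) := by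
      simp only [h𝒮]
      refine Finset.filter_congr fun D _ => ?_
      simp only [show ¬ (L ≤ l) from by omega, false_or]
    rw [hfl]
    have h := scheme_sum_two_sided p hp hϰ hA2 (mm := M2 (l + 1)) (n := n) (N := N) h1 h2 h3 h5 (by have := hn'l l (by omega); omega) hN2
      (hjunk l hl) hH hX hXH
    exact ⟨h.2, h.1⟩
  -- the hypotheses of `kesten_multilevel_osc_le`
  have hne : ∀ l ≤ L, (𝒮 l).Nonempty := by
    have key : ∀ k : ℕ, k ≤ L → (𝒮 (L - k)).Nonempty := by
      intro k hk
      induction k with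
      | zero => exact ⟨C, hCs⟩
      | succ k ih =>
        obtain ⟨C₁, hC₁⟩ := ih (by omega)
        have hl : L - (k + 1) < L := by omega
        have hl1 : L - (k + 1) + 1 = L - k := by omega
        have hC₁' : C₁ ∈ 𝒮 (L - (k + 1) + 1) := by rw [hl1]; exact hC₁
        have hb := (hUN n hnn' le_rfl (L - (k + 1)) hl C₁ hC₁').2
        have hγ₁ := (facts (L - (k + 1) + 1) (by omega) C₁ hC₁').2.1
        by_contra hemp
        rw [Finset.not_nonempty_iff_eq_empty] at hemp
        rw [hemp, Finset.sum_empty] at hb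
        have : 0 < (1 - ε) * γf n C₁ := mul_pos (by linarith) hγ₁
        linarith
    intro l hl
    have := key (L - l) (by omega)
    rwa [show L - (L - l) = l from by omega] at this
  have hMpos : ∀ l < L, ∀ C ∈ 𝒮 (l + 1), ∀ D ∈ 𝒮 l, 0 < Kf l C D := by
    intro l hl C hC D hD
    obtain ⟨⟨hH, -, hX⟩, hγC, -, -, -, hXH⟩ := facts (l + 1) (by omega) C hC
    obtain ⟨⟨hUb, hUa, hR⟩, -, -, hβ, hRb, -⟩ := facts l (by omega) D hD
    obtain ⟨h1, h2, h3⟩ := hμ l hl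
    obtain ⟨h4, h5⟩ := hM l (by omega)
    exact kernel_pos p hϰ hA2 (mm := M2 (l + 1)) (n := n) h1 h2 h3 (by omega) (by have := hn'l l (by omega); omega) hH hX hXH
      hUa hUb hR hRb hγC (hβ.resolve_left (by omega))
  have hcross : ∀ l < L, ∀ C ∈ 𝒮 (l + 1), ∀ C' ∈ 𝒮 (l + 1), ∀ D ∈ 𝒮 l, ∀ D' ∈ 𝒮 l,
      Kf l C D * Kf l C' D' ≤ 1 / ϰ ^ 2 * (Kf l C D' * Kf l C' D) := by
    intro l hl C hC C' hC' D hD D' hD'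
    obtain ⟨⟨hH, -, hX⟩, -, -, -, -, hXH⟩ := facts (l + 1) (by omega) C hC
    obtain ⟨⟨hH', -, hX'⟩, -, -, -, -, hXH'⟩ := facts (l + 1) (by omega) C' hC'
    obtain ⟨⟨hUb, hUa, hR⟩, -, -, -, hRb, -⟩ := facts l (by omega) D hD
    obtain ⟨⟨hUb', hUa', hR'⟩, -, -, -, hRb', -⟩ := facts l (by omega) D' hD'
    obtain ⟨h1, h2, h3⟩ := hμ l hl
    obtain ⟨h4, h5⟩ := hM l (by omega)
    have hHm : C.1 ⊆ box d (2 * M2 (l + 1) + 1 - 1) := by rw [Nat.add_sub_cancel]; exact hH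
    have hHm' : C'.1 ⊆ box d (2 * M2 (l + 1) + 1 - 1) := by rw [Nat.add_sub_cancel]; exact hH'
    have h : ϰ ^ 2 * (Kf l C D * Kf l C' D') ≤ Kf l C D' * Kf l C' D :=
      kernel_crossRatio_le p hϰ.le hA2 (m := 2 * M2 (l + 1) + 1) (c := 2 * μ1 l - 1) (s := 2 * μ2 l) (a := 2 * M1 l) (b := 2 * M2 l)
        (by omega) (by omega) (by omega) (by omega) (by omega) hHm hX hXH hHm' hX' hXH' hUa hUb hR hRb hUa' hUb' hR' hRb'
    rw [one_div]
    exact (le_inv_mul_iff₀ (by positivity)).2 h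
  have hU0 : ∀ D ∈ 𝒮 0, 0 < γf n D := fun D hD => (facts 0 (by omega) D hD).2.1
  have hU0' : ∀ D ∈ 𝒮 0, 0 < γf n' D := by
    intro D hD
    obtain ⟨⟨-, -, hR⟩, hγ, -⟩ := facts 0 (by omega) D hD
    have hM0 := hM 0 (Nat.zero_le _)
    exact lt_of_lt_of_le hγ (real_conn_anti p (by omega) hnn' (hR.trans (box_mono d (by omega))))
  have osc := kesten_multilevel_osc_le 𝒮 Kf (fun _ D => γf n D) (fun _ D => γf n' D) Q L hK hε0 hε1 hne hMpos hcross hU0 hU0'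
    (fun l hl C hC => hUN n hnn' le_rfl l hl C hC) (fun l hl C hC => hUN n' le_rfl hnn' l hl C hC) hQ1 (fun l hl _ => hQ l hl)
    L hL le_rfl C hCs C' hC's
  -- unpack the double ratio
  have hML := hM L le_rfl
  have hn'L := hn'l L le_rfl
  have h1 : 0 < γf n' C :=
    lt_of_lt_of_le hCγ (real_conn_anti p (by omega) hnn' ((facts L le_rfl C hCs).1.2.2.trans (box_mono d (by omega))))
  have h2 : 0 < γf n C' := hC'γ
  change γf n C / γf n' C / (γf n C' / γf n' C') ≤ Q L at osc
  change γf n C * γf n' C' ≤ Q L * (γf n C' * γf n' C)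
  rw [div_div_div_eq, div_le_iff₀ (mul_pos h1 h2)] at osc
  linarith [mul_comm (γf n C') (γf n' C)]


end Summit.CriticalPhenomena.PercolationContinuityZ3.Theorems.Crossing

end
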